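import Mathlib.LinearAlgebra.Matrix.Block
import Mathlib.LinearAlgebra.Matrix.MvPolynomial
import Literature.NumberTheory.Automorphic.RegularFunctionsGL
import HarnessLib

/-!
# The Gauss (block `LDU`) decomposition in `GL n`: uniqueness and regularity of the factors
(trunk T-AUTOMORPHIC, G25 AutomorphicL; the big cell of `GL n`)

Companion to `RegularFunctionsGL.lean` and `BigCell.lean` (namespace `Literature.Automorphic`, concrete
`k`-points vocabulary: coordinates `glCoordFun`, regular functions on principal opens
`IsRegularOnGL`). Fix a *weight function* `b : n → α` into a linear order; it cuts `n × n`
matrices into blocks. We consider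

* `IsBlockUpperUnipotent b r` — `r i j = 0` unless `b i ≤ b j`, and the diagonal blocks
  `{b = a} × {b = a}` of `r` are identity matrices;
* `IsBlockLowerUnipotent b ℓ` — the transpose condition;
* `IsBlockDiagonalFor b t` — `t i j = 0` unless `b i = b j`;
* `leadMinor b g a = det (g.toBlock (b · < a) (b · < a))`, the leading block minors.

and prove the classical facts about the *Gauss decomposition* `g = ℓ t r` (a.k.a. block `LDU`
decomposition; for `b` injective and `n = Fin N` this is the big cell `U⁻ T U` of `GL_N` relative
to the diagonal torus and the upper triangular Borel subgroup, Springer 8.3.11 for `G = GL_n`):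

* `gaussS b g` (definition, over any commutative ring): the matrix whose `j`-th column solves, by
  Cramer's rule in the leading block of level `b j`, the equations making `g · gaussS b g` block
  lower triangular (`mul_gaussS_apply_of_lt`); it is block upper triangular with scalar diagonal
  blocks `leadMinor b g (b j)` (`gaussS_blockTriangular`, `gaussS_apply_of_eq`), has polynomial
  entries and commutes with ring homomorphisms (`gaussS_map`);
* **uniqueness** (`IsBlockUpperUnipotent.eq_of_mul_blockTriangular`): for `g` invertible there
  is at most one block upper unipotent `s` with `g s` block lower triangular;
* **the Gauss decomposition is unique and its factors are rational functions of `g`**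
  (`gauss_unique`): if `g = ℓ t r` with `ℓ` block lower unipotent, `t` block diagonal invertible
  and `r` block upper unipotent, then all leading block minors of `g` are non-zero and
  `ℓ = gaussL b g`, `t = gaussD b g`, `r = gaussU b g` for explicit matrix-valued functions
  `gaussL`, `gaussD`, `gaussU` built from `gaussS b g`, `gaussS b gᵀ`, `g` and the inverses of
  the leading minors;
* **regularity** (`isRegularOnGL_gaussL/D/U`): every entry of `gaussL b g`, `gaussD b g`,
  `gaussU b g` is a regular function on the principal open subset `{gaussDenom b ≠ 0}` of
  `GL n k`, where `gaussDenom b = ∏_j leadMinor (b j)` (`eval_gaussDenom`), and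
  `gaussDenom b (1) = 1`.

No existence statement is needed by the consumer (the reduction of the open big cell of a
connected reductive `G ≤ GL_N`, `BigCell.lean`, to Springer 8.2.1 and 8.3.11: there the
decomposition `g = ℓ t r` is *given* by the structure theory and only the regularity of
`g ↦ (ℓ, t, r)` is wanted, which in `GL_N` is the present elementary fact rather than
Springer's appeal to 5.3.2 (iii) in the proof of 8.3.6 (ii)).

## Mathlib

Used: `Matrix.BlockTriangular` with `BlockTriangular.mul`, `BlockTriangular.det`,
`blockTriangular_inv_of_blockTriangular`, `Matrix.twoBlockTriangular_det'`,
`Matrix.toBlock`, `Matrix.toBlock_mul_eq_add`, `Matrix.toSquareBlock`, `Matrix.cramer`,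
`Matrix.mulVec_cramer`, `Matrix.map_updateCol`, `RingHom.map_det`, `RingHom.map_adjugate`,
`Matrix.mvPolynomialX`. Mathlib has the `LDL` decomposition only for positive definite matrices
over `𝕜 = ℝ, ℂ` (`Mathlib/Analysis/Matrix/LDL.lean`, via Gram–Schmidt), and no `LU`/Gauss
decomposition over a general field (`lean search` for `LDU`, `Bruhat`, `bigCell`: no Mathlib hits).

## Literature tree

`Literature/NumberTheory/Automorphic/ParabolicGL.lean` (standard parabolic subgroups of `GL n`
for a block structure `c`; not importable here without its representation-theoretic imports)
has the same shapes at the level of *invertible* matrices: for `g ∈ GL n R`,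
`IsBlockUpperUnipotent b ↑g` is membership in the unipotent radical `Literature.unipotentRadicalGL R b`
(`mem_unipotentRadicalGL_iff`: block triangular with identity diagonal blocks), and an invertible
block diagonal matrix (`IsBlockDiagonalFor`) is an element of the standard Levi subgroup
`Literature.standardLeviGL b`; its lemma `Matrix.BlockTriangular.toSquareBlock_mul` is the statement of
`toSquareBlock_mul_of_blockTriangular` below (in the generality of a
`NonUnitalNonAssocSemiring`). The matrix-level predicates over a commutative ring are kept here
because the Gauss candidates `gaussS`, `gaussS₁` are plain matrices (possibly singular off the
big cell); bridging lemmas belong to a file importing both.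

## References

* T. A. Springer, *Linear Algebraic Groups*, 2nd ed. (1998), 8.3.6 (ii), 8.3.9, 8.3.11 (for
  `GL_n`: exercise 8.3.12 (2)) [SpringerLAG1998].
* A. Borel, *Linear Algebraic Groups*, 2nd ed. (1991), IV.14.12–14.14 (the big cell).
-/

open scoped MatrixGroups
open Matrix OrderDual

noncomputable section

namespace Literature.NumberTheory.Automorphic

variable {R S : Type*} [CommRing R] [CommRing S] {n : Type*} [Fintype n] [DecidableEq n]
variable {α : Type*} [LinearOrder α] (b : n → α)

/-! ### Block unipotent and block diagonal matrices -/

section BlockAlgebra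

/-- `r` is *block upper unipotent* for the weight function `b`: `r i j = 0` when `b j < b i`
(block upper triangular, Mathlib `Matrix.BlockTriangular r b`) and the diagonal blocks
`{b = a} × {b = a}` are identity matrices. [folklore] -/
def IsBlockUpperUnipotent (r : Matrix n n R) : Prop :=
  r.BlockTriangular b ∧ ∀ i j, b i = b j → r i j = (1 : Matrix n n R) i j

/-- `ℓ` is *block lower unipotent* for `b`: `ℓ i j = 0` when `b i < b j` and the diagonal blocks
are identity matrices; i.e. block upper unipotent for the reversed order. [folklore] -/
def IsBlockLowerUnipotent (ℓ : Matrix n n R) : Prop :=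
  ℓ.BlockTriangular (toDual ∘ b) ∧ ∀ i j, b i = b j → ℓ i j = (1 : Matrix n n R) i j

/-- `t` is *block diagonal* for `b`: `t i j = 0` unless `b i = b j`. [folklore] -/
def IsBlockDiagonalFor (t : Matrix n n R) : Prop :=
  ∀ i j, b i ≠ b j → t i j = 0

variable {b}

omit [Fintype n] in
/-- The identity matrix is symmetric (entrywise). [folklore] -/
theorem one_apply_comm (i j : n) : (1 : Matrix n n R) i j = (1 : Matrix n n R) j i := by
  conv_lhs => rw [← transpose_one]
  rw [transpose_apply]

omit [Fintype n] in
/-- Block lower unipotent is block upper unipotent for the dual order (definitional). [folklore] -/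
theorem isBlockLowerUnipotent_iff (ℓ : Matrix n n R) :
    IsBlockLowerUnipotent b ℓ ↔ IsBlockUpperUnipotent (toDual ∘ b) ℓ :=
  Iff.rfl

omit [Fintype n] [DecidableEq n] in
/-- A block diagonal matrix is block upper triangular. [folklore] -/
theorem IsBlockDiagonalFor.blockTriangular {t : Matrix n n R} (ht : IsBlockDiagonalFor b t) :
    t.BlockTriangular b :=
  fun _ _ h => ht _ _ h.ne'

omit [Fintype n] [DecidableEq n] in
/-- A block diagonal matrix is block lower triangular. [folklore] -/
theorem IsBlockDiagonalFor.blockTriangular_dual {t : Matrix n n R} (ht : IsBlockDiagonalFor b t) :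
    t.BlockTriangular (toDual ∘ b) :=
  fun _ _ h => ht _ _ (toDual_lt_toDual.mp h).ne

omit [Fintype n] in
/-- The transpose of a block lower unipotent matrix is block upper unipotent. [folklore] -/
theorem IsBlockLowerUnipotent.transpose {ℓ : Matrix n n R} (hℓ : IsBlockLowerUnipotent b ℓ) :
    IsBlockUpperUnipotent b ℓᵀ :=
  ⟨fun _ _ h => hℓ.1 (toDual_lt_toDual.mpr h), fun i j h => by
    rw [transpose_apply, hℓ.2 j i h.symm, one_apply_comm]⟩

omit [Fintype n] in
/-- The transpose of a block upper unipotent matrix is block lower unipotent. [folklore] -/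
theorem IsBlockUpperUnipotent.transpose {r : Matrix n n R} (hr : IsBlockUpperUnipotent b r) :
    IsBlockLowerUnipotent b rᵀ :=
  ⟨fun _ _ h => hr.1 (toDual_lt_toDual.mp h), fun i j h => by
    rw [transpose_apply, hr.2 j i h.symm, one_apply_comm]⟩

omit [Fintype n] [DecidableEq n] [LinearOrder α] in
/-- The transpose of a block diagonal matrix is block diagonal. [folklore] -/
theorem IsBlockDiagonalFor.transpose {t : Matrix n n R} (ht : IsBlockDiagonalFor b t) :
    IsBlockDiagonalFor b tᵀ :=
  fun i j h => ht j i (Ne.symm h)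

variable (b) in
omit [DecidableEq n] in
/-- **Diagonal blocks of a product of block upper triangular matrices** are the products of
the diagonal blocks. (Same statement as `Matrix.BlockTriangular.toSquareBlock_mul` of
`ParabolicGL.lean`, which is not importable here; to be deduplicated into a light shared file.)
[folklore] -/
theorem toSquareBlock_mul_of_blockTriangular {M N : Matrix n n R} (hM : M.BlockTriangular b)
    (hN : N.BlockTriangular b) (a : α) :
    (M * N).toSquareBlock b a = M.toSquareBlock b a * N.toSquareBlock b a := by
  ext i j
  simp only [toSquareBlock_def, of_apply, Matrix.mul_apply]
  rw [← Fintype.sum_subtype_add_sum_subtype (fun l => b l = a) (fun l => M i l * N l j)]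
  conv_rhs => rw [← add_zero (∑ l : {l // b l = a}, M i l * N l j)]
  congr 1
  refine Finset.sum_eq_zero fun l _ => ?_
  rcases lt_or_gt_of_ne l.2 with h | h
  · rw [hM (h.trans_eq i.2.symm), zero_mul]
  · rw [hN (j.2.trans_lt h), mul_zero]

omit [Fintype n] in
/-- The diagonal blocks of a block upper unipotent matrix are identity matrices. [folklore] -/
theorem IsBlockUpperUnipotent.toSquareBlock_eq_one {r : Matrix n n R}
    (hr : IsBlockUpperUnipotent b r) (a : α) : r.toSquareBlock b a = 1 := by
  ext i j
  rw [toSquareBlock_def, of_apply, hr.2 i j (i.2.trans j.2.symm), Matrix.one_apply,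
    Matrix.one_apply]
  simp [Subtype.ext_iff]

/-- A block upper unipotent matrix has determinant `1`. [folklore] -/
theorem IsBlockUpperUnipotent.det_eq_one {r : Matrix n n R} (hr : IsBlockUpperUnipotent b r) :
    r.det = 1 := by
  rw [hr.1.det]
  exact Finset.prod_eq_one fun a _ => by rw [hr.toSquareBlock_eq_one a, det_one]

/-- A block lower unipotent matrix has determinant `1`. [folklore] -/
theorem IsBlockLowerUnipotent.det_eq_one {ℓ : Matrix n n R} (hℓ : IsBlockLowerUnipotent b ℓ) :
    ℓ.det = 1 := by
  rw [← det_transpose]; exact hℓ.transpose.det_eq_one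

omit [Fintype n] in
/-- A block upper unipotent matrix restricted to a `b`-saturated set of indices (e.g. a leading
block `{b < a}`) is block upper unipotent. [folklore] -/
theorem IsBlockUpperUnipotent.toBlock {r : Matrix n n R} (hr : IsBlockUpperUnipotent b r)
    (p : n → Prop) : IsBlockUpperUnipotent (fun i : {i // p i} => b i) (r.toBlock p p) :=
  ⟨fun _ _ h => hr.1 h, fun i j h => by
    rw [toBlock_apply, hr.2 i j h, Matrix.one_apply, Matrix.one_apply]
    simp [Subtype.ext_iff]⟩

/-- **The inverse of a block upper unipotent matrix is block upper unipotent.** [folklore] -/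
theorem IsBlockUpperUnipotent.inv {r : Matrix n n R} (hr : IsBlockUpperUnipotent b r) :
    IsBlockUpperUnipotent b r⁻¹ := by
  have hdet : IsUnit r.det := by rw [hr.det_eq_one]; exact isUnit_one
  haveI : Invertible r := invertibleOfIsUnitDet r hdet
  have hinv : r⁻¹.BlockTriangular b := blockTriangular_inv_of_blockTriangular hr.1
  refine ⟨hinv, fun i j hij => ?_⟩
  have hblk := toSquareBlock_mul_of_blockTriangular b hinv hr.1 (b j)
  rw [nonsing_inv_mul r hdet, hr.toSquareBlock_eq_one, Matrix.mul_one] at hblk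
  have h := congr_fun (congr_fun hblk ⟨i, hij⟩) ⟨j, rfl⟩
  simp only [toSquareBlock_def, of_apply] at h
  exact h.symm

/-- The inverse of a block lower unipotent matrix is block lower unipotent. [folklore] -/
theorem IsBlockLowerUnipotent.inv {ℓ : Matrix n n R} (hℓ : IsBlockLowerUnipotent b ℓ) :
    IsBlockLowerUnipotent b ℓ⁻¹ :=
  (isBlockLowerUnipotent_iff _).mpr ((isBlockLowerUnipotent_iff _).mp hℓ).inv

omit [Fintype n] in
/-- A matrix which is block upper and block lower triangular with identity diagonal blocks is
the identity. [folklore] -/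
theorem eq_one_of_blockTriangular_of_toSquareBlock {x : Matrix n n R} (hu : x.BlockTriangular b)
    (hl : x.BlockTriangular (toDual ∘ b))
    (hd : ∀ i j, b i = b j → x i j = (1 : Matrix n n R) i j) :
    x = 1 := by
  ext i j
  rcases lt_trichotomy (b i) (b j) with h | h | h
  · rw [hl (toDual_lt_toDual.mpr h), Matrix.one_apply_ne fun hij => h.ne (congrArg b hij)]
  · exact hd i j h
  · rw [hu h, Matrix.one_apply_ne fun hij => h.ne' (congrArg b hij)]

/-- **Uniqueness in the Gauss decomposition.** If `g` is invertible and `s`, `s'` are block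
upper unipotent matrices such that both `g s` and `g s'` are block lower triangular, then
`s = s'`. (Then `g = (g s) s⁻¹` with `g s` block lower triangular: the upper unipotent factor
of `g` is unique; cf. Springer 8.3.9 for `GL_n`.) [folklore] -/
theorem IsBlockUpperUnipotent.eq_of_mul_blockTriangular {g s s' : Matrix n n R}
    (hg : IsUnit g.det) (hs : IsBlockUpperUnipotent b s) (hs' : IsBlockUpperUnipotent b s')
    (hL : (g * s).BlockTriangular (toDual ∘ b)) (hL' : (g * s').BlockTriangular (toDual ∘ b)) :
    s = s' := by
  have hsdet : IsUnit s.det := by rw [hs.det_eq_one]; exact isUnit_one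
  have hLdet : IsUnit (g * s).det := by rw [det_mul]; exact hg.mul hsdet
  haveI : Invertible (g * s) := invertibleOfIsUnitDet _ hLdet
  set x : Matrix n n R := (g * s)⁻¹ * (g * s') with hx
  have hx_lower : x.BlockTriangular (toDual ∘ b) :=
    (blockTriangular_inv_of_blockTriangular hL).mul hL'
  have hsx : s * x = s' := by
    have h1 : g * (s * x) = g * s' := by
      rw [← Matrix.mul_assoc, hx, mul_nonsing_inv_cancel_left _ _ hLdet]
    rw [← nonsing_inv_mul_cancel_left g (s * x) hg, h1, nonsing_inv_mul_cancel_left g s' hg]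
  have hx' : x = s⁻¹ * s' := by
    rw [← hsx, nonsing_inv_mul_cancel_left s x hsdet]
  have hx_upper : x.BlockTriangular b := by rw [hx']; exact hs.inv.1.mul hs'.1
  have hx_diag : ∀ i j, b i = b j → x i j = (1 : Matrix n n R) i j := by
    intro i j hij
    have hblk := toSquareBlock_mul_of_blockTriangular b hs.inv.1 hs'.1 (b j)
    rw [← hx', hs.inv.toSquareBlock_eq_one, hs'.toSquareBlock_eq_one, Matrix.mul_one] at hblk
    have h := congr_fun (congr_fun hblk ⟨i, hij⟩) ⟨j, rfl⟩
    simp only [toSquareBlock_def, of_apply] at h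
    rw [h, Matrix.one_apply, Matrix.one_apply]
    simp [Subtype.ext_iff]
  have hx1 : x = 1 := eq_one_of_blockTriangular_of_toSquareBlock hx_upper hx_lower hx_diag
  rw [← hsx, hx1, Matrix.mul_one]

end BlockAlgebra

/-! ### Leading block minors and the Cramer candidate for the upper factor -/

section Gauss

/-- The leading block `{b < a} × {b < a}` of `g`. [folklore] -/
def leadBlock (g : Matrix n n R) (a : α) : Matrix {i // b i < a} {i // b i < a} R :=
  g.toBlock (fun i => b i < a) (fun i => b i < a)

/-- The leading block minor `Δ_a(g) = det (g|_{{b < a} × {b < a}})`. [folklore] -/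
def leadMinor (g : Matrix n n R) (a : α) : R :=
  (leadBlock b g a).det

/-- The Cramer candidate `S(g)` for (the inverse of) the block upper unipotent factor of `g`,
scaled to have polynomial entries: for `b i < b j`, `S(g) i j` is the `i`-th component of the
Cramer solution `v` of `g|_{<b j} · v = Δ_{b j}(g) · (-g_{· j})`, the diagonal blocks are the
scalars `Δ_{b j}(g)`, and the entries below the block diagonal vanish. [folklore] -/
def gaussS (g : Matrix n n R) : Matrix n n R :=
  Matrix.of fun i j =>
    if h : b i < b j then Matrix.cramer (leadBlock b g (b j)) (fun l => -g l j) ⟨i, h⟩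
    else if i = j then leadMinor b g (b j) else 0

variable {b}

/-- The leading minors of the identity matrix are `1`. [folklore] -/
@[simp] theorem leadMinor_one (a : α) : leadMinor b (1 : Matrix n n R) a = 1 := by
  rw [leadMinor, leadBlock, toBlock_one_self, det_one]

omit [CommRing R] [Fintype n] [DecidableEq n] in
/-- The leading blocks of the transpose are the transposes of the leading blocks. [folklore] -/
theorem leadBlock_transpose (g : Matrix n n R) (a : α) :
    leadBlock b gᵀ a = (leadBlock b g a)ᵀ := by
  ext i j; rfl

/-- The leading minors of `gᵀ` are those of `g`. [folklore] -/
@[simp] theorem leadMinor_transpose (g : Matrix n n R) (a : α) :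
    leadMinor b gᵀ a = leadMinor b g a := by
  rw [leadMinor, leadBlock_transpose, det_transpose, leadMinor]

omit [Fintype n] [DecidableEq n] in
/-- Leading blocks commute with ring homomorphisms. [folklore] -/
theorem leadBlock_map (f : R →+* S) (g : Matrix n n R) (a : α) :
    leadBlock b (g.map f) a = (leadBlock b g a).map f := by
  ext i j; rfl

/-- Leading minors commute with ring homomorphisms. [folklore] -/
theorem leadMinor_map (f : R →+* S) (g : Matrix n n R) (a : α) :
    leadMinor b (g.map f) a = f (leadMinor b g a) := by
  rw [leadMinor, leadBlock_map, leadMinor, RingHom.map_det, RingHom.mapMatrix_apply]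

/-- `S(g)` is block upper triangular. [folklore] -/
theorem gaussS_blockTriangular (g : Matrix n n R) : (gaussS b g).BlockTriangular b := by
  intro i j hij
  simp only [gaussS, of_apply, dif_neg (not_lt.mpr hij.le)]
  rw [if_neg]
  rintro rfl
  exact lt_irrefl _ hij

/-- The diagonal blocks of `S(g)` are the scalars `Δ_{b j}(g)`. [folklore] -/
theorem gaussS_apply_of_eq (g : Matrix n n R) {i j : n} (hij : b i = b j) :
    gaussS b g i j = if i = j then leadMinor b g (b j) else 0 := by
  have h : ¬b i < b j := by rw [hij]; exact lt_irrefl _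
  simp only [gaussS, of_apply, dif_neg h]

/-- The entries of `S(g)` above the block diagonal are the Cramer solutions. [folklore] -/
theorem gaussS_apply_of_lt (g : Matrix n n R) {i j : n} (hij : b i < b j) :
    gaussS b g i j = Matrix.cramer (leadBlock b g (b j)) (fun l => -g l j) ⟨i, hij⟩ := by
  simp only [gaussS, of_apply, dif_pos hij]

/-- **`g · S(g)` is block lower triangular** (a polynomial identity, by Cramer's rule
`A · cramer A c = det A · c` in the leading blocks). [folklore] -/
theorem mul_gaussS_apply_of_lt (g : Matrix n n R) {i j : n} (hij : b i < b j) :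
    (g * gaussS b g) i j = 0 := by
  rw [Matrix.mul_apply,
    ← Fintype.sum_subtype_add_sum_subtype (fun l => b l < b j) (fun l => g i l * gaussS b g l j)]
  have h1 : ∑ l : {l // b l < b j}, g i l * gaussS b g l j = leadMinor b g (b j) * -g i j := by
    have hc := congr_fun (Matrix.mulVec_cramer (leadBlock b g (b j)) (fun l => -g l j)) ⟨i, hij⟩
    simp only [Matrix.mulVec, dotProduct, Pi.smul_apply, smul_eq_mul] at hc
    rw [← leadMinor] at hc
    rw [← hc]
    refine Finset.sum_congr rfl fun l _ => ?_
    rw [gaussS_apply_of_lt g l.2]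
    rfl
  have h2 : ∑ l : {l // ¬b l < b j}, g i l * gaussS b g l j = g i j * leadMinor b g (b j) := by
    rw [Fintype.sum_eq_single ⟨j, lt_irrefl _⟩]
    · rw [gaussS_apply_of_eq g rfl, if_pos rfl]
    · intro l hl
      have hlj : (l : n) ≠ j := fun h => hl (Subtype.ext h)
      have : gaussS b g l j = 0 := by
        simp only [gaussS, of_apply, dif_neg l.2, if_neg hlj]
      rw [this, mul_zero]
  rw [h1, h2]
  ring

/-- `(g · S(g))` is block lower triangular. [folklore] -/
theorem mul_gaussS_blockTriangular (g : Matrix n n R) :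
    (g * gaussS b g).BlockTriangular (toDual ∘ b) :=
  fun _ _ h => mul_gaussS_apply_of_lt g (toDual_lt_toDual.mp h)

/-- **`S` commutes with ring homomorphisms**: the entries of `S(g)` are fixed polynomials with
integer coefficients in the entries of `g` (determinants of leading blocks with one column
replaced). [folklore] -/
theorem gaussS_map (f : R →+* S) (g : Matrix n n R) :
    gaussS b (g.map f) = (gaussS b g).map f := by
  ext i j
  rw [Matrix.map_apply]
  by_cases hij : b i < b j
  · rw [gaussS_apply_of_lt _ hij, gaussS_apply_of_lt _ hij, Matrix.cramer_apply,
      Matrix.cramer_apply, leadBlock_map, RingHom.map_det, RingHom.mapMatrix_apply,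
      Matrix.map_updateCol]
    congr 2
    funext l
    simp
  · simp only [gaussS, of_apply, dif_neg hij]
    split_ifs with h
    · exact leadMinor_map f g (b j)
    · exact (map_zero f).symm

/-! ### The normalised candidate and the Gauss factors (over a field) -/

variable {k : Type*} [Field k]
variable (b) in
/-- The normalised candidate `S₁(g) = S(g) · diag(Δ_{b j}(g)⁻¹)`: block upper unipotent with
`g · S₁(g)` block lower triangular as soon as all leading block minors of `g` are non-zero;
then `S₁(g)` is the inverse of the block upper unipotent Gauss factor of `g`. [folklore] -/
def gaussS₁ (g : Matrix n n k) : Matrix n n k :=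
  gaussS b g * Matrix.diagonal fun j => (leadMinor b g (b j))⁻¹

variable (b) in
/-- The block upper unipotent Gauss factor `r` of `g = ℓ t r`, as a function of `g`:
`U(g) = S₁(g)⁻¹`. [folklore] -/
def gaussU (g : Matrix n n k) : Matrix n n k :=
  (gaussS₁ b g)⁻¹

variable (b) in
/-- The block lower unipotent Gauss factor `ℓ` of `g = ℓ t r`, as a function of `g`:
`L(g) = (S₁(gᵀ)ᵀ)⁻¹`. [folklore] -/
def gaussL (g : Matrix n n k) : Matrix n n k :=
  ((gaussS₁ b gᵀ)ᵀ)⁻¹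

variable (b) in
/-- The block diagonal Gauss factor `t` of `g = ℓ t r`, as a function of `g`:
`D(g) = S₁(gᵀ)ᵀ · g · S₁(g)`. [folklore] -/
def gaussD (g : Matrix n n k) : Matrix n n k :=
  (gaussS₁ b gᵀ)ᵀ * g * gaussS₁ b g

/-- Entries of `S₁(g)`. [folklore] -/
theorem gaussS₁_apply (g : Matrix n n k) (i j : n) :
    gaussS₁ b g i j = gaussS b g i j * (leadMinor b g (b j))⁻¹ := by
  rw [gaussS₁, Matrix.mul_diagonal]

/-- If all leading block minors of `g` are non-zero, `S₁(g)` is block upper unipotent.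
[folklore] -/
theorem isBlockUpperUnipotent_gaussS₁ {g : Matrix n n k}
    (hΔ : ∀ j, leadMinor b g (b j) ≠ 0) :
    IsBlockUpperUnipotent b (gaussS₁ b g) := by
  refine ⟨fun i j h => ?_, fun i j h => ?_⟩
  · rw [gaussS₁_apply, gaussS_blockTriangular g h, zero_mul]
  · rw [gaussS₁_apply, gaussS_apply_of_eq g h, Matrix.one_apply]
    split_ifs with hij
    · exact mul_inv_cancel₀ (hΔ j)
    · exact zero_mul _

/-- `g · S₁(g)` is block lower triangular. [folklore] -/
theorem mul_gaussS₁_blockTriangular (g : Matrix n n k) :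
    (g * gaussS₁ b g).BlockTriangular (toDual ∘ b) := by
  intro i j h
  rw [gaussS₁, ← Matrix.mul_assoc, Matrix.mul_diagonal,
    mul_gaussS_apply_of_lt g (toDual_lt_toDual.mp h), zero_mul]

/-- **The upper factor.** If `g = m r` with `m` block lower triangular and invertible and `r`
block upper unipotent, then all leading block minors of `g` are non-zero and `r⁻¹ = S₁(g)`.
(The leading block of `g` of level `a` is `m|_{<a} · r|_{<a}`, of determinant
`det m|_{<a} ≠ 0`; then uniqueness.) [folklore] -/
theorem inv_eq_gaussS₁_of_eq_mul {g m r : Matrix n n k} (hm : m.BlockTriangular (toDual ∘ b))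
    (hmu : m.det ≠ 0) (hr : IsBlockUpperUnipotent b r) (hg : g = m * r) :
    (∀ a, leadMinor b g a ≠ 0) ∧ r⁻¹ = gaussS₁ b g := by
  have hvan : ∀ a, ∀ i, b i < a → ∀ j, ¬b j < a → m i j = 0 := fun a i hi j hj =>
    hm (toDual_lt_toDual.mpr (hi.trans_le (not_lt.mp hj)))
  have hΔ : ∀ a, leadMinor b g a ≠ 0 := by
    intro a
    have hzero : m.toBlock (fun i => b i < a) (fun i => ¬b i < a) = 0 := by
      ext i j
      exact hvan a i i.2 j j.2
    have hblk : leadBlock b g a = leadBlock b m a * leadBlock b r a := by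
      rw [leadBlock, hg, toBlock_mul_eq_add (fun i => b i < a) (fun i => b i < a)
        (fun i => b i < a) m r, hzero, Matrix.zero_mul, add_zero]
      rfl
    have hdetm : m.det = leadMinor b m a *
        (m.toBlock (fun i => ¬b i < a) (fun i => ¬b i < a)).det :=
      twoBlockTriangular_det' m (fun i => b i < a) (hvan a)
    have hm' : leadMinor b m a ≠ 0 := by
      intro h0
      rw [h0, zero_mul] at hdetm
      exact hmu hdetm
    have hr' : leadMinor b r a = 1 := (hr.toBlock fun i => b i < a).det_eq_one
    rw [leadMinor, hblk, det_mul, ← leadMinor, ← leadMinor, hr', mul_one]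
    exact hm'
  refine ⟨hΔ, ?_⟩
  have hrdet : IsUnit r.det := by rw [hr.det_eq_one]; exact isUnit_one
  have hgdet : IsUnit g.det := by
    rw [hg, det_mul, hr.det_eq_one, mul_one]
    exact isUnit_iff_ne_zero.mpr hmu
  refine hr.inv.eq_of_mul_blockTriangular hgdet (isBlockUpperUnipotent_gaussS₁ fun j => hΔ (b j))
    ?_ (mul_gaussS₁_blockTriangular g)
  rw [hg, mul_nonsing_inv_cancel_right r m hrdet]
  exact hm

/-- **The lower factor** (transpose of the previous statement). If `g = ℓ m'` with `ℓ` block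
lower unipotent and `m'` block upper triangular and invertible, then all leading block minors of
`g` are non-zero and `ℓ⁻¹ = S₁(gᵀ)ᵀ`. [folklore] -/
theorem inv_eq_gaussS₁_transpose_of_eq_mul {g ℓ m' : Matrix n n k}
    (hℓ : IsBlockLowerUnipotent b ℓ) (hm' : m'.BlockTriangular b) (hmu : m'.det ≠ 0)
    (hg : g = ℓ * m') : (∀ a, leadMinor b g a ≠ 0) ∧ ℓ⁻¹ = (gaussS₁ b gᵀ)ᵀ := by
  have hgt : gᵀ = m'ᵀ * ℓᵀ := by rw [hg, transpose_mul]
  obtain ⟨hΔ, hinv⟩ := inv_eq_gaussS₁_of_eq_mul (b := b) hm'.transpose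
    (by rwa [det_transpose]) hℓ.transpose hgt
  refine ⟨fun a => by simpa using hΔ a, ?_⟩
  rw [← hinv, ← transpose_nonsing_inv, transpose_transpose]

/-- **Uniqueness of the Gauss decomposition, with explicit factors.** If `g = ℓ t r` with `ℓ`
block lower unipotent, `t` block diagonal and invertible and `r` block upper unipotent (for the
weight function `b`), then every leading block minor of `g` is non-zero and
`ℓ = L(g)`, `t = D(g)`, `r = U(g)` (`gaussL`, `gaussD`, `gaussU`). For `b` injective on
`Fin N` this is the uniqueness of the decomposition in the big cell `U⁻ T U` of `GL_N`
(Springer 8.3.9, 8.3.11 for `GL_n`) together with the rationality of the factors.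
[cite: SpringerLAG1998, 8.3.9 and 8.3.11 (case of GL_n)] -/
theorem gauss_unique {g ℓ t r : Matrix n n k} (hℓ : IsBlockLowerUnipotent b ℓ)
    (ht : IsBlockDiagonalFor b t) (htu : t.det ≠ 0) (hr : IsBlockUpperUnipotent b r)
    (hg : g = ℓ * t * r) :
    (∀ a, leadMinor b g a ≠ 0) ∧ ℓ = gaussL b g ∧ t = gaussD b g ∧ r = gaussU b g := by
  have hℓdet : IsUnit ℓ.det := by rw [hℓ.det_eq_one]; exact isUnit_one
  have hrdet : IsUnit r.det := by rw [hr.det_eq_one]; exact isUnit_one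
  -- upper factor: `m = ℓ t`
  obtain ⟨hΔ, hrinv⟩ := inv_eq_gaussS₁_of_eq_mul (b := b) (g := g) (m := ℓ * t)
    (hℓ.1.mul ht.blockTriangular_dual) (by rw [det_mul, hℓ.det_eq_one, one_mul]; exact htu)
    hr hg
  -- lower factor: `m' = t r`
  obtain ⟨-, hℓinv⟩ := inv_eq_gaussS₁_transpose_of_eq_mul (b := b) (g := g) (m' := t * r)
    hℓ (ht.blockTriangular.mul hr.1) (by rw [det_mul, hr.det_eq_one, mul_one]; exact htu)
    (by rw [hg, Matrix.mul_assoc])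
  refine ⟨hΔ, ?_, ?_, ?_⟩
  · rw [gaussL, ← hℓinv, nonsing_inv_nonsing_inv ℓ hℓdet]
  · rw [gaussD, ← hℓinv, ← hrinv, hg, Matrix.mul_assoc, Matrix.mul_assoc,
      mul_nonsing_inv r hrdet, Matrix.mul_one, nonsing_inv_mul_cancel_left ℓ t hℓdet]
  · rw [gaussU, ← hrinv, nonsing_inv_nonsing_inv r hrdet]

/-- If all leading block minors of `g` are non-zero, `S₁(gᵀ)` is block upper unipotent (so has
determinant `1`). [folklore] -/
theorem isBlockUpperUnipotent_gaussS₁_transpose {g : Matrix n n k}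
    (hΔ : ∀ j, leadMinor b g (b j) ≠ 0) : IsBlockUpperUnipotent b (gaussS₁ b gᵀ) :=
  isBlockUpperUnipotent_gaussS₁ fun j => by simpa using hΔ j

end Gauss

/-! ### Regularity of the Gauss factors on the principal open set `{∏ Δ ≠ 0}` -/

section Regular

variable {k : Type*} [Field k]

/-- The leading block minor of level `a` as a polynomial in the coordinates of `GL n`.
[folklore] -/
noncomputable def leadMinorPoly (a : α) : MvPolynomial (GLCoord n) k :=
  leadMinor b (genericMatrixGL n k) a

/-- The denominator of the Gauss factors: the product over `j` of the leading block minors of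
level `b j` (as a polynomial in the coordinates of `GL n`). [folklore] -/
noncomputable def gaussDenom : MvPolynomial (GLCoord n) k :=
  ∏ j : n, leadMinorPoly b (b j)

variable {b}

/-- The generic matrix evaluated at `g` is `g` (unbundled form of
`eval_mapMatrix_genericMatrixGL`). [folklore] -/
theorem genericMatrixGL_map_eval (g : GL n k) :
    (genericMatrixGL n k).map (MvPolynomial.eval (glCoordFun g)) = (g : Matrix n n k) :=
  eval_mapMatrix_genericMatrixGL g

/-- Evaluating `leadMinorPoly` at `g` gives the leading minor of `g`. [folklore] -/
@[simp] theorem eval_leadMinorPoly (g : GL n k) (a : α) :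
    MvPolynomial.eval (glCoordFun g) (leadMinorPoly b a) = leadMinor b (g : Matrix n n k) a := by
  rw [leadMinorPoly, ← leadMinor_map, genericMatrixGL_map_eval]

/-- Evaluating `gaussDenom` at `g` gives `∏_j Δ_{b j}(g)`. [folklore] -/
theorem eval_gaussDenom (g : GL n k) :
    MvPolynomial.eval (glCoordFun g) (gaussDenom b) =
      ∏ j : n, leadMinor b (g : Matrix n n k) (b j) := by
  simp [gaussDenom, map_prod]

/-- `gaussDenom (g) ≠ 0` iff all the leading block minors `Δ_{b j}(g)` are non-zero.
[folklore] -/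
theorem eval_gaussDenom_ne_zero_iff (g : GL n k) :
    MvPolynomial.eval (glCoordFun g) (gaussDenom b) ≠ 0 ↔
      ∀ j, leadMinor b (g : Matrix n n k) (b j) ≠ 0 := by
  rw [eval_gaussDenom, Finset.prod_ne_zero_iff]
  simp

/-- `gaussDenom (1) = 1`: the identity lies in the principal open set `{gaussDenom ≠ 0}`.
[folklore] -/
theorem eval_gaussDenom_one : MvPolynomial.eval (glCoordFun (1 : GL n k)) (gaussDenom b) = 1 := by
  rw [eval_gaussDenom]
  exact Finset.prod_eq_one fun j _ => by simp

/-- The entries of `S(g)` are polynomial functions of `g`. [folklore] -/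
theorem eval_gaussS_genericMatrixGL (g : GL n k) (i j : n) :
    MvPolynomial.eval (glCoordFun g) (gaussS b (genericMatrixGL n k) i j) =
      gaussS b (g : Matrix n n k) i j := by
  have h := congr_fun (congr_fun (gaussS_map (b := b) (MvPolynomial.eval (glCoordFun g))
    (genericMatrixGL n k)) i) j
  rw [genericMatrixGL_map_eval, Matrix.map_apply] at h
  exact h.symm

/-- The entries of `S(gᵀ)` are polynomial functions of `g`. [folklore] -/
theorem eval_gaussS_genericMatrixGL_transpose (g : GL n k) (i j : n) :
    MvPolynomial.eval (glCoordFun g) (gaussS b (genericMatrixGL n k)ᵀ i j) =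
      gaussS b (g : Matrix n n k)ᵀ i j := by
  have h := congr_fun (congr_fun (gaussS_map (b := b) (MvPolynomial.eval (glCoordFun g))
    (genericMatrixGL n k)ᵀ) i) j
  rw [transpose_map, genericMatrixGL_map_eval, Matrix.map_apply] at h
  exact h.symm

variable {Z : Set (GL n k)}

/-- The inverse of a factor of the denominator is regular: if `d = d₁ d₂` then `1/d₁ = d₂/d`
on `{d ≠ 0}`. [folklore] -/
theorem IsRegularOnGL.inv_of_dvd {d d₁ : MvPolynomial (GLCoord n) k} (h : d₁ ∣ d) :
    IsRegularOnGL Z d fun g => (MvPolynomial.eval (glCoordFun g) d₁)⁻¹ := by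
  obtain ⟨d₂, rfl⟩ := h
  refine ⟨d₂, 1, fun g _ hd => ?_⟩
  rw [map_mul] at hd
  rw [pow_one, map_mul, inv_mul_cancel_left₀ (left_ne_zero_of_mul hd)]

/-- `1 / Δ_{b j}` is regular on `{gaussDenom ≠ 0}`. [folklore] -/
theorem isRegularOnGL_leadMinor_inv (j : n) :
    IsRegularOnGL Z (gaussDenom b) fun g => (leadMinor b (g : Matrix n n k) (b j))⁻¹ := by
  have h : leadMinorPoly (k := k) b (b j) ∣ gaussDenom b :=
    Finset.dvd_prod_of_mem _ (Finset.mem_univ j)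
  exact (IsRegularOnGL.inv_of_dvd h).congr fun g _ _ => by rw [eval_leadMinorPoly]

/-- The entries of `S₁(g)` are regular on `{gaussDenom ≠ 0}`. [folklore] -/
theorem isRegularOnGL_gaussS₁ (i j : n) :
    IsRegularOnGL Z (gaussDenom b) fun g => gaussS₁ b (g : Matrix n n k) i j := by
  have h := (IsRegularOnGL.of_eval (Z := Z) (d := gaussDenom b)
    (gaussS b (genericMatrixGL n k) i j)).mul (isRegularOnGL_leadMinor_inv (b := b) j)
  exact h.congr fun g _ _ => by rw [gaussS₁_apply, eval_gaussS_genericMatrixGL]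

/-- The entries of `S₁(gᵀ)` are regular on `{gaussDenom ≠ 0}`. [folklore] -/
theorem isRegularOnGL_gaussS₁_transpose (i j : n) :
    IsRegularOnGL Z (gaussDenom b) fun g => gaussS₁ b (g : Matrix n n k)ᵀ i j := by
  have h := (IsRegularOnGL.of_eval (Z := Z) (d := gaussDenom b)
    (gaussS b (genericMatrixGL n k)ᵀ i j)).mul (isRegularOnGL_leadMinor_inv (b := b) j)
  exact h.congr fun g _ _ => by
    rw [gaussS₁_apply, eval_gaussS_genericMatrixGL_transpose, leadMinor_transpose]

/-- Products of matrix-valued functions with regular entries have regular entries. [folklore] -/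
theorem IsRegularOnGL.matrix_mul {m : Type*} [Fintype m] {d : MvPolynomial (GLCoord n) k}
    {M : GL n k → Matrix m m k} {N : GL n k → Matrix m m k}
    (hM : ∀ i j, IsRegularOnGL Z d fun g => M g i j)
    (hN : ∀ i j, IsRegularOnGL Z d fun g => N g i j)
    (i j : m) : IsRegularOnGL Z d fun g => (M g * N g) i j := by
  simp only [Matrix.mul_apply]
  exact IsRegularOnGL.sum _ fun l _ => (hM i l).mul (hN l j)

/-- The adjugate of a matrix-valued function with regular entries has regular entries (its
entries are polynomials in the entries). [folklore] -/
theorem IsRegularOnGL.matrix_adjugate {m : Type*} [Fintype m] [DecidableEq m]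
    {d : MvPolynomial (GLCoord n) k} {M : GL n k → Matrix m m k}
    (hM : ∀ i j, IsRegularOnGL Z d fun g => M g i j) (i j : m) :
    IsRegularOnGL Z d fun g => (M g).adjugate i j := by
  have h := IsRegularOnGL.eval_comp (Z := Z) (d := d) (cs := fun (pq : m × m) g => M g pq.1 pq.2)
    (fun pq => hM pq.1 pq.2) ((Matrix.mvPolynomialX m m k).adjugate i j)
  refine h.congr fun g _ _ => ?_
  have e := RingHom.map_adjugate (MvPolynomial.eval fun pq : m × m => M g pq.1 pq.2)
    (Matrix.mvPolynomialX m m k)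
  rw [Matrix.mvPolynomialX_mapMatrix_eval] at e
  have e' := congr_fun (congr_fun e i) j
  rw [RingHom.mapMatrix_apply, Matrix.map_apply] at e'
  exact e'.symm

/-- The inverse of a matrix-valued function with regular entries and determinant `1` on the
principal open set has regular entries. [folklore] -/
theorem IsRegularOnGL.matrix_inv_of_det_eq_one {m : Type*} [Fintype m] [DecidableEq m]
    {d : MvPolynomial (GLCoord n) k} {M : GL n k → Matrix m m k}
    (hM : ∀ i j, IsRegularOnGL Z d fun g => M g i j)
    (hdet : ∀ g ∈ Z, MvPolynomial.eval (glCoordFun g) d ≠ 0 → (M g).det = 1) (i j : m) :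
    IsRegularOnGL Z d fun g => (M g)⁻¹ i j := by
  refine (IsRegularOnGL.matrix_adjugate hM i j).congr fun g hg hd => ?_
  rw [Matrix.inv_def, hdet g hg hd, Ring.inverse_one, one_smul]

/-- **The entries of the upper Gauss factor `U(g)` are regular on `{gaussDenom ≠ 0}`.**
[folklore] -/
theorem isRegularOnGL_gaussU (i j : n) :
    IsRegularOnGL Z (gaussDenom b) fun g => gaussU b (g : Matrix n n k) i j := by
  unfold gaussU
  refine IsRegularOnGL.matrix_inv_of_det_eq_one
    (M := fun g : GL n k => gaussS₁ b (g : Matrix n n k))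
    (fun i j => isRegularOnGL_gaussS₁ i j) (fun g _ hd => ?_) i j
  exact (isBlockUpperUnipotent_gaussS₁ ((eval_gaussDenom_ne_zero_iff g).mp hd)).det_eq_one

/-- The entries of `S₁(gᵀ)ᵀ` are regular on `{gaussDenom ≠ 0}`. [folklore] -/
theorem isRegularOnGL_gaussS₁_transpose_transpose (i j : n) :
    IsRegularOnGL Z (gaussDenom b) fun g => (gaussS₁ b (g : Matrix n n k)ᵀ)ᵀ i j :=
  isRegularOnGL_gaussS₁_transpose j i

/-- **The entries of the lower Gauss factor `L(g)` are regular on `{gaussDenom ≠ 0}`.**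
[folklore] -/
theorem isRegularOnGL_gaussL (i j : n) :
    IsRegularOnGL Z (gaussDenom b) fun g => gaussL b (g : Matrix n n k) i j := by
  unfold gaussL
  refine IsRegularOnGL.matrix_inv_of_det_eq_one
    (M := fun g : GL n k => (gaussS₁ b (g : Matrix n n k)ᵀ)ᵀ)
    (fun i j => isRegularOnGL_gaussS₁_transpose_transpose i j) (fun g _ hd => ?_) i j
  rw [det_transpose]
  exact (isBlockUpperUnipotent_gaussS₁_transpose
    ((eval_gaussDenom_ne_zero_iff g).mp hd)).det_eq_one

/-- **The entries of the block diagonal Gauss factor `D(g)` are regular on `{gaussDenom ≠ 0}`.**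
[folklore] -/
theorem isRegularOnGL_gaussD (i j : n) :
    IsRegularOnGL Z (gaussDenom b) fun g => gaussD b (g : Matrix n n k) i j := by
  unfold gaussD
  have h1 : ∀ i j, IsRegularOnGL Z (gaussDenom b)
      fun g : GL n k => ((gaussS₁ b (g : Matrix n n k)ᵀ)ᵀ * (g : Matrix n n k)) i j :=
    IsRegularOnGL.matrix_mul (M := fun g : GL n k => (gaussS₁ b (g : Matrix n n k)ᵀ)ᵀ)
      (N := fun g : GL n k => (g : Matrix n n k))
      (fun i j => isRegularOnGL_gaussS₁_transpose_transpose i j)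
      (fun i j => IsRegularOnGL.coord (Sum.inl (i, j)))
  exact IsRegularOnGL.matrix_mul
    (M := fun g : GL n k => (gaussS₁ b (g : Matrix n n k)ᵀ)ᵀ * (g : Matrix n n k))
    (N := fun g : GL n k => gaussS₁ b (g : Matrix n n k)) h1
    (fun i j => isRegularOnGL_gaussS₁ i j) i j

end Regular

end Literature.NumberTheory.Automorphic

end
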